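import Summits.BirchSwinnertonDyer.BirchSwinnertonDyer.Theorems.Rank2ObservatoryTateDeepIstar
import HarnessLib

/-!
# Rank-2 observatory (b2b-bsdr2, cert-2 gen 7): Tate certificates for Steps 6–10 — part 3/3:
# the certificate `DeepCert`, soundness, the conductor exponent, kernel self-tests

HONEST FRAMING: per-curve certified theorems and census instruments; no claim on BSD in rank ≥ 2.

## The certificate

`DeepCert = ⟨p, r, s, t, n, exit, m⟩`: the translation `(1, r, s, t)` to the FINAL model `M` of the
algorithm (for `Iₙ*`: the model of the round that exits), `n = v_p(Δ)`, the exit and the round `m`.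
`DeepCert.check W₀ : Bool` verifies on `M = (1,r,s,t) • W₀` (integer arithmetic only): `pⁿ ∥ Δ`,
`p ∣ a₁`, and
* exit `6`  (`I₀*`):        `p ∣ a₂`, `p² ∣ a₃, a₄`, `p³ ∣ a₆`, `p ∤ disc(T³ + (a₂/p)T² + (a₄/p²)T + a₆/p³)`;
* exit `71` (`I*_{2m+1}`):  `p ∥ a₂`, `p^{m+2} ∣ a₃`, `p^{m+3} ∣ a₄`, `p^{2m+4} ∣ a₆`,
                            `p ∤ (a₃/p^{m+2})² + 4·a₆/p^{2m+4}`, `m + 1 ≤ n`;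
* exit `72` (`I*_{2m+2}`):  `p ∥ a₂`, `p^{m+3} ∣ a₃, a₄`, `p^{2m+5} ∣ a₆`,
                            `p ∤ (a₄/p^{m+3})² − 4·(a₂/p)·(a₆/p^{2m+5})`, `m + 1 ≤ n`;
* exit `8`  (`IV*`):        `p² ∣ a₂, a₃`, `p³ ∣ a₄`, `p⁴ ∣ a₆`, `p ∤ (a₃/p²)² + 4·a₆/p⁴`;
* exit `9`  (`III*`):       `p² ∣ a₂`, `p³ ∣ a₃`, `p³ ∥ a₄`, `p⁵ ∣ a₆`;
* exit `10` (`II*`):        `p² ∣ a₂`, `p³ ∣ a₃`, `p⁴ ∣ a₄`, `p⁵ ∥ a₆`.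

`DeepCert.sound`: if `check` holds and `M ⊗ ℚ` is minimal at the place `v` over `p`, then `W₀ ⊗ ℚ`
has Kodaira type `DeepCert.type` and `ord_v Δ_min = n` at `v` (parts 1–2 supply the algorithm's
verdict on the cast of `M` in every presentation `p = ϖ ε` of `O_v`); hence
`conductorExponent v = f := n + 1 − #components` (Ogg's formula is the tree's definition).

MINIMALITY IS AN INPUT of `sound` / `conductorExponent_int_eq` (`IsMinimalAt` / `IsGloballyMinimal`):
for `Iₙ*` at `2` with `n ≥ 4` one has `v₂(Δ) ≥ 12` and `v₂(c₄) ≥ 4`, so no valuation criterion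
applies; census rows get it from the tree theorem `Rank3Row.isGloballyMinimal_of_mem` (gen 5,
Kraus–Laska, hypothesis-free).  `sound'` / `conductorExponent_int_eq'` are the hypothesis-free
variants under Silverman's criterion `minCrit` (`n < 12` or `v_p(c₄) < 4`, *AEC* VII.1.1), used by
the self-tests.

## Engines

Engine 1 = `tate/tate_deep.py` (own implementation of Tate Steps 1–10 on integer models, emitting the
certificates); engine 2 = PARI `elllocalred` (Kodaira type, `f_p`); the Lean kernel re-verifies every
certificate by `decide`.  On the rank-3 census the two engines agree on all 3 024 rows additive at
`2` and all 1 550 rows additive at `3` (type incl. `ν`, and `f`); the ten self-test curves below are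
census rows (engine 1 = engine 2 = kernel).
-/

open scoped NumberField
open Polynomial IsLocalRing IsDedekindDomain Rat.HeightOneSpectrum WeierstrassCurve
  Literature.NumberTheory.EllipticCurves Literature.NumberTheory.GaloisRepresentations
  Literature.NumberTheory.DiophantineGeometry Literature.NumberTheory.DiophantineGeometry.TateAlgorithm

namespace Summit.BirchSwinnertonDyer.BirchSwinnertonDyer.Rank2Observatory.Tate

/-! ### The certificate -/

/-- A Tate certificate for Steps 6–10 at the prime `p` on an integer model: the change of variables
`(1, r, s, t)` to the FINAL normalised model of the algorithm, `n = v_p(Δ)`, the exit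
(`6 ↦ I₀*`, `71 ↦ I*_{2m+1}`, `72 ↦ I*_{2m+2}`, `8 ↦ IV*`, `9 ↦ III*`, `10 ↦ II*`) and the round
`m` of the `Iₙ*` sub-procedure (else `0`). [cite: Silverman1994, IV.9.4 Steps 6–10] -/
structure DeepCert where
  /-- the prime -/
  p : ℕ
  /-- translation `x = x' + r` -/
  r : ℤ
  /-- `y = y' + s x' + t` -/
  s : ℤ
  /-- `y = y' + s x' + t` -/
  t : ℤ
  /-- `n = v_p(Δ)` -/
  n : ℕ
  /-- exit: `6` (`I₀*`), `71` (`I*` odd), `72` (`I*` even), `8` (`IV*`), `9` (`III*`), `10` (`II*`) -/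
  exit : ℕ
  /-- the round of the `Iₙ*` sub-procedure (`ν = 2m+1` resp. `2m+2`); `0` otherwise -/
  m : ℕ
  deriving Repr, DecidableEq, Inhabited

namespace DeepCert

open Step2Cert (pdvd pexact pexact_iff)

variable (c : DeepCert) (W : WeierstrassCurve ℤ)

/-- The underlying Step-2 certificate shape (same `(p, r, s, t, n)`), used for its `model`.
[cite: SilvermanAEC2009, III.1 Table 3.1] -/
def toStep2 : Step2Cert := ⟨c.p, c.r, c.s, c.t, c.n, 0, 0⟩

/-- The translated integer model `(1, r, s, t) • W`. [cite: SilvermanAEC2009, III.1 Table 3.1] -/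
def model : WeierstrassCurve ℤ := c.toStep2.model W

/-- The Kodaira type certified by the exit. [cite: Silverman1994, IV.9.4 Steps 6–10] -/
def type : KodairaSymbol :=
  if c.exit = 6 then .Istar 0 else if c.exit = 71 then .Istar (2 * c.m + 1)
  else if c.exit = 72 then .Istar (2 * c.m + 2) else if c.exit = 8 then .IVstar
  else if c.exit = 9 then .IIIstar else .IIstar

/-- The certified conductor exponent `n + 1 - #components` (Ogg's formula). [cite: Silverman1994, IV.11.1] -/
def f : ℕ := c.n + 1 - c.type.numComponents

/-- The kernel-decidable check of a deep Tate certificate on the final model `M = (1,r,s,t) • W`: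
`pⁿ ∥ Δ`, `p ∣ a₁`, and the divisibilities + exit test of Step 6 / 7 (round `m`, first or second
test) / 8 / 9 / 10, the tests being read on INTEGER quotients `aᵢ / pʲ`.
[cite: Silverman1994, IV.9.4 Steps 6–10] -/
def check : Bool :=
  let M := c.model W
  let q : ℤ := c.p
  pexact c.p c.n M.Δ && pdvd c.p 1 M.a₁ &&
  ((c.exit == 6 && pdvd c.p 1 M.a₂ && pdvd c.p 2 M.a₃ && pdvd c.p 2 M.a₄ && pdvd c.p 3 M.a₆ &&
      !pdvd c.p 1 (disc3 (M.a₂ / q ^ 1) (M.a₄ / q ^ 2) (M.a₆ / q ^ 3))) ||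
   (c.exit == 71 && pexact c.p 1 M.a₂ && pdvd c.p (c.m + 2) M.a₃ && pdvd c.p (c.m + 3) M.a₄ &&
      pdvd c.p (2 * c.m + 4) M.a₆ && decide (c.m + 1 ≤ c.n) &&
      !pdvd c.p 1 ((M.a₃ / q ^ (c.m + 2)) ^ 2 + 4 * (M.a₆ / q ^ (2 * c.m + 4)))) ||
   (c.exit == 72 && pexact c.p 1 M.a₂ && pdvd c.p (c.m + 3) M.a₃ && pdvd c.p (c.m + 3) M.a₄ &&
      pdvd c.p (2 * c.m + 5) M.a₆ && decide (c.m + 1 ≤ c.n) &&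
      !pdvd c.p 1 ((M.a₄ / q ^ (c.m + 3)) ^ 2 - 4 * (M.a₂ / q ^ 1) * (M.a₆ / q ^ (2 * c.m + 5)))) ||
   (c.exit == 8 && pdvd c.p 2 M.a₂ && pdvd c.p 2 M.a₃ && pdvd c.p 3 M.a₄ && pdvd c.p 4 M.a₆ &&
      !pdvd c.p 1 ((M.a₃ / q ^ 2) ^ 2 + 4 * (M.a₆ / q ^ 4))) ||
   (c.exit == 9 && pdvd c.p 2 M.a₂ && pdvd c.p 3 M.a₃ && pexact c.p 3 M.a₄ && pdvd c.p 5 M.a₆) ||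
   (c.exit == 10 && pdvd c.p 2 M.a₂ && pdvd c.p 3 M.a₃ && pdvd c.p 4 M.a₄ && pexact c.p 5 M.a₆))

/-- Silverman's minimality criteria as a Boolean: `n < 12` or `v_p(c₄(W)) < 4`
(*AEC* VII.1.1; `c₄` is translation invariant). [cite: SilvermanAEC2009, VII.1 Remark 1.1] -/
def minCrit : Bool :=
  decide (c.n < 12) || pexact c.p 0 W.c₄ || pexact c.p 1 W.c₄ || pexact c.p 2 W.c₄ ||
    pexact c.p 3 W.c₄

variable {c W}

/-- The engine behind `sound`: the exit disjunction of `check`, read in `O_v`. [cite: Silverman1994, IV.9.4] -/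
theorem kodairaSymbolOfMinimal_of_check {R : Type*} [CommRing R] [IsDomain R]
    [IsDiscreteValuationRing R] [PerfectField (ResidueField R)] (hp : c.p.Prime) {ε : R}
    (hε : IsUnit ε) (hpε : (c.p : R) = uniformizer R * ε) (hc : c.check W = true) :
    ((c.model W).map (Int.castRingHom R)).kodairaSymbolOfMinimal = c.type := by
  simp only [check, Bool.and_eq_true, Bool.or_eq_true, beq_iff_eq, decide_eq_true_eq, pexact_iff,
    Bool.not_eq_true', decide_eq_false_iff_not, pdvd] at hc
  obtain ⟨⟨⟨hΔ, hΔ'⟩, h1⟩, hexit⟩ := hc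
  rcases hexit with ((((⟨⟨⟨⟨⟨hx, h2⟩, h3⟩, h4⟩, h6⟩, hd⟩ |
      ⟨⟨⟨⟨⟨⟨hx, h2, h2'⟩, h3⟩, h4⟩, h6⟩, hm⟩, hA⟩) |
      ⟨⟨⟨⟨⟨⟨hx, h2, h2'⟩, h3⟩, h4⟩, h6⟩, hm⟩, hB⟩) | ⟨⟨⟨⟨⟨hx, h2⟩, h3⟩, h4⟩, h6⟩, hq⟩) |
      ⟨⟨⟨⟨hx, h2⟩, h3⟩, h4, h4'⟩, h6⟩) | ⟨⟨⟨⟨hx, h2⟩, h3⟩, h4⟩, h6, h6'⟩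
  · simp only [type, hx]
    exact kodairaSymbolOfMinimal_intCast_eq_Istar_zero hp hε hpε h1 h2 h3 h4 h6 hd
  · simp only [type, hx]
    exact kodairaSymbolOfMinimal_intCast_eq_Istar_odd hp hε hpε h1 h2 h2' h3 h4 h6 hA hΔ hΔ' hm
  · simp only [type, hx]
    exact kodairaSymbolOfMinimal_intCast_eq_Istar_even hp hε hpε h1 h2 h2' h3 h4 h6 hB hΔ hΔ' hm
  · simp only [type, hx]
    exact kodairaSymbolOfMinimal_intCast_eq_IVstar hp hε hpε h1 h2 h3 h4 h6 hq
  · simp only [type, hx]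
    exact kodairaSymbolOfMinimal_intCast_eq_IIIstar hp hε hpε h1 h2 h3 h4 h4' h6
  · simp only [type, hx]
    exact kodairaSymbolOfMinimal_intCast_eq_IIstar hp hε hpε h1 h2 h3 h4 h6 h6'

/-- `check` gives `pⁿ ∥ Δ(model)`. [folklore] -/
theorem pexact_Δ_of_check (hc : c.check W = true) :
    (c.p : ℤ) ^ c.n ∣ (c.model W).Δ ∧ ¬ (c.p : ℤ) ^ (c.n + 1) ∣ (c.model W).Δ := by
  simp only [check, Bool.and_eq_true, Bool.or_eq_true, beq_iff_eq, decide_eq_true_eq, pexact_iff,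
    Bool.not_eq_true', decide_eq_false_iff_not, pdvd] at hc
  exact hc.1.1

/-- **Soundness of the deep Tate certificate, given minimality at `v`**: if `c.check W₀` holds and
`W₀ ⊗ ℚ` is minimal at the place `v` above `c.p`, then `W₀ ⊗ ℚ` has Kodaira type `c.type` and
`ord_v Δ_min = c.n` at `v` — NO named fact.  (Minimality is an INPUT here: for `I*_ν` at `2` with
`ν ≥ 4` neither `n < 12` nor `v(c₄) < 4` holds; the census supplies it from the tree's Kraus–Laska
theorem `Rank3Row.isGloballyMinimal_of_mem`.) [cite: Silverman1994, IV.9.4 Steps 6–10] -/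
theorem sound {W₀ : WeierstrassCurve ℤ} {c : DeepCert} (v : HeightOneSpectrum (𝓞 ℚ))
    (hv : natGenerator v = c.p) (hmin : (W₀.baseChange ℚ).IsMinimalAt v) (hc : c.check W₀ = true) :
    (W₀.baseChange ℚ).kodairaSymbolAt v = c.type ∧
      (W₀.baseChange ℚ).ordMinimalDiscriminant v = c.n := by
  haveI := perfectField_residueField_adicCompletionIntegers (K := ℚ) v
  have hp : c.p.Prime := hv ▸ prime_natGenerator v
  obtain ⟨hΔ, hΔ'⟩ := pexact_Δ_of_check hc
  exact kodairaSymbolAt_and_ordMinimalDiscriminant_of_intModel v hv W₀ (c.model W₀) ⟨1, c.r, c.s, c.t⟩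
    rfl (Step2Cert.model_eq c.toStep2 W₀)
      (isMinimalAt_translate v ⟨1, c.r, c.s, c.t⟩ rfl (Step2Cert.model_eq c.toStep2 W₀) hmin) hΔ hΔ'
    (fun ε hε hpε ↦ kodairaSymbolOfMinimal_of_check hp hε hpε hc)

/-- **Soundness, hypothesis-free form**: `check` plus Silverman's criterion `minCrit`
(`n < 12` or `v_p(c₄) < 4`) gives type and `ord_v Δ_min` with NO hypothesis.
[cite: Silverman1994, IV.9.4 Steps 6–10] [cite: SilvermanAEC2009, VII.1 Remark 1.1] -/
theorem sound' {W₀ : WeierstrassCurve ℤ} {c : DeepCert} (v : HeightOneSpectrum (𝓞 ℚ))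
    (hv : natGenerator v = c.p) (hc : c.check W₀ = true) (hm : c.minCrit W₀ = true) :
    (W₀.baseChange ℚ).kodairaSymbolAt v = c.type ∧
      (W₀.baseChange ℚ).ordMinimalDiscriminant v = c.n := by
  haveI := perfectField_residueField_adicCompletionIntegers (K := ℚ) v
  have hp : c.p.Prime := hv ▸ prime_natGenerator v
  obtain ⟨hΔ, hΔ'⟩ := pexact_Δ_of_check hc
  have hc₄ : (c.model W₀).c₄ = W₀.c₄ := by rw [model, Step2Cert.model_eq, variableChange_c₄]; simp
  have hcrit : c.n < 12 ∨ ∃ k < 4, (c.p : ℤ) ^ k ∣ (c.model W₀).c₄ ∧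
      ¬ (c.p : ℤ) ^ (k + 1) ∣ (c.model W₀).c₄ := by
    rw [hc₄]
    simp only [minCrit, Bool.or_eq_true, decide_eq_true_eq, pexact_iff] at hm
    rcases hm with (((h | h) | h) | h) | h
    · exact Or.inl h
    · exact Or.inr ⟨0, by omega, h⟩
    · exact Or.inr ⟨1, by omega, h⟩
    · exact Or.inr ⟨2, by omega, h⟩
    · exact Or.inr ⟨3, by omega, h⟩
  exact kodairaSymbolAt_and_ordMinimalDiscriminant_of_intModel v hv W₀ (c.model W₀) ⟨1, c.r, c.s, c.t⟩
    rfl (Step2Cert.model_eq c.toStep2 W₀) (isMinimalAt_of_criterion v hv _ hΔ hΔ' hcrit) hΔ hΔ'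
    (fun ε hε hpε ↦ kodairaSymbolOfMinimal_of_check hp hε hpε hc)

/-- The check implies `Δ ≠ 0` over `ℚ`. [folklore] -/
theorem isElliptic_of_check {W₀ : WeierstrassCurve ℤ} {c : DeepCert} (hc : c.check W₀ = true) :
    (W₀.baseChange ℚ).IsElliptic := by
  obtain ⟨-, hΔ'⟩ := pexact_Δ_of_check hc
  have hΔW : (c.model W₀).Δ = W₀.Δ := by rw [model, Step2Cert.model_eq, variableChange_Δ]; simp
  refine ⟨(show (W₀.baseChange ℚ).Δ ≠ 0 from ?_).isUnit⟩
  rw [(Step2Cert.baseChange_eqs W₀).2.2.2.2.2.2.2.2, Int.cast_ne_zero]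
  rintro h0; rw [hΔW, h0] at hΔ'; exact hΔ' (dvd_zero _)

/-- **The conductor exponent from a deep certificate** at a place of `𝓞 ℚ` (Ogg's formula is the
definition of `conductorExponent`): `f_v = n + 1 - #components`, given minimality at `v`.
[cite: Silverman1994, IV.11.1] -/
theorem conductorExponent_eq {W₀ : WeierstrassCurve ℤ} {c : DeepCert} (v : HeightOneSpectrum (𝓞 ℚ))
    (hv : natGenerator v = c.p) (hmin : (W₀.baseChange ℚ).IsMinimalAt v) (hc : c.check W₀ = true) :
    (W₀.baseChange ℚ).conductorExponent v = c.f := by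
  obtain ⟨hK, hn⟩ := sound v hv hmin hc
  unfold WeierstrassCurve.conductorExponent WeierstrassCurve.numComponentsAt DeepCert.f
  rw [hK, hn]

/-- The place of `𝓞 ℚ` matching a place of `ℤ` under `primesEquiv`, with its generator. [folklore] -/
theorem exists_place_of_int (v : HeightOneSpectrum ℤ) :
    ∃ v' : HeightOneSpectrum (𝓞 ℚ), (primesEquiv v : Nat.Primes) = primesEquiv v' ∧
      natGenerator v' = natGenerator v := by
  refine ⟨(primesEquiv (R := 𝓞 ℚ)).symm (primesEquiv v), by rw [Equiv.apply_symm_apply], ?_⟩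
  have h1 : ∀ w : HeightOneSpectrum (𝓞 ℚ), ((primesEquiv w : Nat.Primes) : ℕ) = natGenerator w :=
    fun _ ↦ rfl
  have h2 : ((primesEquiv v : Nat.Primes) : ℕ) = natGenerator v := rfl
  rw [← h1, Equiv.apply_symm_apply, h2]

/-- **The conductor exponent from a deep certificate at a place of `ℤ`**, for a GLOBALLY MINIMAL
integer model (the census curves are: `Rank3Row.isGloballyMinimal_of_mem`).
[cite: Silverman1994, IV.11.1] -/
theorem conductorExponent_int_eq {W₀ : WeierstrassCurve ℤ} {c : DeepCert} (v : HeightOneSpectrum ℤ)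
    (hv : natGenerator v = c.p) (hGM : (W₀.baseChange ℚ).IsGloballyMinimal) (hc : c.check W₀ = true) :
    (W₀.baseChange ℚ).conductorExponent v = c.f := by
  haveI := isElliptic_of_check hc
  obtain ⟨v', hvv', hgen⟩ := exists_place_of_int v
  rw [conductorExponent_eq_of_primesEquiv_eq v v' _ hvv']
  exact conductorExponent_eq v' (hgen.trans hv) (hGM.isMinimal v') hc

/-- **The conductor exponent from a deep certificate at a place of `ℤ`, hypothesis-free** (with
Silverman's criterion `minCrit`). [cite: Silverman1994, IV.11.1] [cite: SilvermanAEC2009, VII.1.1] -/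
theorem conductorExponent_int_eq' {W₀ : WeierstrassCurve ℤ} {c : DeepCert} (v : HeightOneSpectrum ℤ)
    (hv : natGenerator v = c.p) (hc : c.check W₀ = true) (hm : c.minCrit W₀ = true) :
    (W₀.baseChange ℚ).conductorExponent v = c.f := by
  haveI := isElliptic_of_check hc
  obtain ⟨v', hvv', hgen⟩ := exists_place_of_int v
  rw [conductorExponent_eq_of_primesEquiv_eq v v' _ hvv']
  obtain ⟨hK, hn⟩ := sound' v' (hgen.trans hv) hc hm
  unfold WeierstrassCurve.conductorExponent WeierstrassCurve.numComponentsAt DeepCert.f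
  rw [hK, hn]

end DeepCert

/-! ### Self-tests (engine 1 = `tate_deep.py`, engine 2 = PARI `elllocalred`; kernel = `decide`) -/

namespace DeepCert

/-- `90704c1 = [0,1,0,-77,-281]` (`N = 2⁴·5669`): final model `(r,s,t) = (1,0,2)`, type `I₀*` at `2`,
`v₂(Δ) = 8`, `f₂ = 4` — the kernel check of the certificate. [cite: CremonaAlgorithms1997, Tables] -/
theorem check_90704c1 : check ⟨2, 1, 0, 2, 8, 6, 0⟩ ⟨0, 1, 0, -77, -281⟩ = true := by
  decide +kernel

/-- **`f₂(90704c1) = 4`, hypothesis-free** (type `I₀*` at `2`). [cite: CremonaAlgorithms1997, Tables] -/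
theorem conductorExponent_two_90704c1 (v : HeightOneSpectrum ℤ) (hv : natGenerator v = 2) :
    ((⟨0, 1, 0, -77, -281⟩ : WeierstrassCurve ℤ).baseChange ℚ).conductorExponent v = 4 :=
  conductorExponent_int_eq' (c := ⟨2, 1, 0, 2, 8, 6, 0⟩) v hv check_90704c1 (by decide +kernel)

/-- **`f₂(20888a1) = 3`** (`[0,0,0,-52,100]`, `N = 2³·7·373`; type `I₁*` at `2`, `v₂(Δ) = 8`,
round `0` first test), hypothesis-free. [cite: CremonaAlgorithms1997, Tables] -/
theorem conductorExponent_two_20888a1 (v : HeightOneSpectrum ℤ) (hv : natGenerator v = 2) :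
    ((⟨0, 0, 0, -52, 100⟩ : WeierstrassCurve ℤ).baseChange ℚ).conductorExponent v = 3 :=
  conductorExponent_int_eq' (c := ⟨2, 2, 0, 2, 8, 71, 0⟩) v hv (by decide +kernel) (by decide +kernel)

/-- **`f₂(46896d1) = 4`** (`[0,-1,0,-72,144]`, `N = 2⁴·3·977`; type `I₃*` at `2`, `v₂(Δ) = 11`,
round `1` first test), hypothesis-free. [cite: CremonaAlgorithms1997, Tables] -/
theorem conductorExponent_two_46896d1 (v : HeightOneSpectrum ℤ) (hv : natGenerator v = 2) :
    ((⟨0, -1, 0, -72, 144⟩ : WeierstrassCurve ℤ).baseChange ℚ).conductorExponent v = 4 :=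
  conductorExponent_int_eq' (c := ⟨2, 0, 1, 4, 11, 71, 1⟩) v hv (by decide +kernel) (by decide +kernel)

/-- **`f₂(30064c1) = 4`** (`[0,1,0,-152,676]`, `N = 2⁴·1879`; type `I₂*` at `2`, `v₂(Δ) = 10`,
round `0` second test), hypothesis-free. [cite: CremonaAlgorithms1997, Tables] -/
theorem conductorExponent_two_30064c1 (v : HeightOneSpectrum ℤ) (hv : natGenerator v = 2) :
    ((⟨0, 1, 0, -152, 676⟩ : WeierstrassCurve ℤ).baseChange ℚ).conductorExponent v = 4 :=
  conductorExponent_int_eq' (c := ⟨2, 2, 1, 8, 10, 72, 0⟩) v hv (by decide +kernel) (by decide +kernel)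

/-- **`f₂(33428a1) = 2`** (`[0,1,0,-45,79]`, `N = 2²·61·137`; type `IV*` at `2`, `v₂(Δ) = 8`),
hypothesis-free. [cite: CremonaAlgorithms1997, Tables] -/
theorem conductorExponent_two_33428a1 (v : HeightOneSpectrum ℤ) (hv : natGenerator v = 2) :
    ((⟨0, 1, 0, -45, 79⟩ : WeierstrassCurve ℤ).baseChange ℚ).conductorExponent v = 2 :=
  conductorExponent_int_eq' (c := ⟨2, 1, 0, 2, 8, 8, 0⟩) v hv (by decide +kernel) (by decide +kernel)

/-- **`f₂(136952a2) = 3`** (`[0,1,0,-23120,-1339376]`, `N = 2³·17119`; type `III*` at `2`,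
`v₂(Δ) = 10`), hypothesis-free. [cite: CremonaAlgorithms1997, Tables] -/
theorem conductorExponent_two_136952a2 (v : HeightOneSpectrum ℤ) (hv : natGenerator v = 2) :
    ((⟨0, 1, 0, -23120, -1339376⟩ : WeierstrassCurve ℤ).baseChange ℚ).conductorExponent v = 3 :=
  conductorExponent_int_eq' (c := ⟨2, 0, 1, 4, 10, 9, 0⟩) v hv (by decide +kernel) (by decide +kernel)

/-- **`f₃(42264a1) = 2`** (`[0,0,0,-252,1620]`, `N = 2³·3²·587`; type `I₀*` at `3`, `v₃(Δ) = 6`),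
hypothesis-free. [cite: CremonaAlgorithms1997, Tables] -/
theorem conductorExponent_three_42264a1 (v : HeightOneSpectrum ℤ) (hv : natGenerator v = 3) :
    ((⟨0, 0, 0, -252, 1620⟩ : WeierstrassCurve ℤ).baseChange ℚ).conductorExponent v = 2 :=
  conductorExponent_int_eq' (c := ⟨3, 0, 0, 0, 6, 6, 0⟩) v hv (by decide +kernel) (by decide +kernel)

/-- **`f₃(38439b1) = 2`** (`[0,0,1,-57,76]`, `N = 3²·4271`; type `I₁*` at `3`, `v₃(Δ) = 7`),
hypothesis-free. [cite: CremonaAlgorithms1997, Tables] -/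
theorem conductorExponent_three_38439b1 (v : HeightOneSpectrum ℤ) (hv : natGenerator v = 3) :
    ((⟨0, 0, 1, -57, 76⟩ : WeierstrassCurve ℤ).baseChange ℚ).conductorExponent v = 2 :=
  conductorExponent_int_eq' (c := ⟨3, 1, 0, 4, 7, 71, 0⟩) v hv (by decide +kernel) (by decide +kernel)

/-- **`f₃(305217b1) = 2`** (`[0,0,1,27024,1254600]`, `N = 3²·33913`; type `I₁₀*` at `3`,
`v₃(Δ) = 16`, round `4` second test, `v₃(c₄) = 2`), hypothesis-free. [cite: CremonaAlgorithms1997, Tables] -/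
theorem conductorExponent_three_305217b1 (v : HeightOneSpectrum ℤ) (hv : natGenerator v = 3) :
    ((⟨0, 0, 1, 27024, 1254600⟩ : WeierstrassCurve ℤ).baseChange ℚ).conductorExponent v = 2 :=
  conductorExponent_int_eq' (c := ⟨3, 170, 0, 1093, 16, 72, 4⟩) v hv (by decide +kernel)
    (by decide +kernel)

/-- **`f₃(68499j1) = 3`** (`[0,0,1,-459,3800]`, `N = 3³·43·59`; type `IV*` at `3`, `v₃(Δ) = 9`),
hypothesis-free. [cite: CremonaAlgorithms1997, Tables] -/
theorem conductorExponent_three_68499j1 (v : HeightOneSpectrum ℤ) (hv : natGenerator v = 3) :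
    ((⟨0, 0, 1, -459, 3800⟩ : WeierstrassCurve ℤ).baseChange ℚ).conductorExponent v = 3 :=
  conductorExponent_int_eq' (c := ⟨3, 3, 0, 4, 9, 8, 0⟩) v hv (by decide +kernel) (by decide +kernel)

end DeepCert

end Summit.BirchSwinnertonDyer.BirchSwinnertonDyer.Rank2Observatory.Tate
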